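import Literature.MathematicalPhysics.QuantumFieldTheory.Balaban1983to89.Node00.BgSchemeOfRecordProp4
import Literature.MathematicalPhysics.QuantumFieldTheory.Balaban1983to89.Node00.BgSchemeOfRecord
import HarnessLib

/-!
# The FRAMED («double-bar») averaging of record over an explicit frame DATUM `𝔥`: `Ū^{pr} = h • Ū^{ff}`, `Q^{pr}_k(U₀)`, `C^{pr}`, `C^{sl,pr}` — edition (ρ-frame-min), file A2

statement-level skeleton of published definitions with citation tags; nothing here is a claim about the Yang–Mills mass gap
(cell `pub-ymgap`, unit `pub-ymgap-node00-def-Y` g40; Node00 = the record `(F : T4Family, SU(N), avOfRecord)`; road (ρ-frame-min) = director №601∕№608,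
interface line bus I.13306 (D1)–(D5), second reader's pre-bytes note I.13312 and READ 13 (α)–(δ) folded in: the analyticity window is a field
of the datum, the frame term is ORIENTED as the coarse covariant difference (package (P+)), and §4 is the kernel guard `D(C^{pr} − C)(0) = 0` they asked for).
CONVENTION: every identity of this layer is meant under the small-field guard `SmallBelow (avOfRecord F N K) k U₀` of `U₀` below `k`, as file 3e′;
there the three names of the background average — `iterM k ↑U₀` (in `frameCorr`, as `qSkewOp`), `iterMh k ↑U₀` (`avPrM_bg`) and `↑(Ū^k U₀)` (the base of
`logOver` in `CprOfRecord`) — agree (`coeField_iter_eq_iterM`, `iterMh_coeField_of_smallBelow`), and `Ū₀(c)Ū₀(c)⋆ = 1`.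

WHY.  Print's k-th step letters `Q̄_k(U₀)` ([Balaban1985BackgroundPropagators] (3.13)–(3.16)) and the remainder `C` of [Balaban1985Variational] (44) are
built on the `k`-th order average taken in the HIERARCHICAL FRAME of [Balaban1985Averaging] (78)–(92) («`Ū̿ = h • Ū`», (92); (3.113)), for which (3.114)
«`Q̄(U₀)(D_{U₀}λ) = ∂(Q′λ)`» holds with `Q′` the BLOCK-MEAN site letter (3.18)–(3.19) (the tree's `QprimeOfRecord`).  The tree's un-framed holomorphic
iterate `iterMh` (its `qCplxOp`∕`QOfRecord`∕`COfRecord`, files 3b∕3e′) linearises pure gauge modes to CENTRE VALUES instead ((1.55)♭, ✓`qCplxOp_covGradM`),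
whose right inverse `H₁♭` is point-pinned and `H²`-critical in `d = 4` (bus I.13273 (2), ◆ nodeO l.5879: the k-uniform rows (46)∕(3.133) are false at scale
for the frame-free pair).  This file types the framed letters OVER A FRAME DATUM `𝔥 : FrameDatum P N k U₀` — an INTERFACE (window, frame, inverse frame,
analyticity, triviality at the background, derivative letter), NOT a construction: nothing existential, no `Classical.choose`; the record's inhabitant
`hierFrameDatumOfRecord` ((78)–(87) over the record's contours) is file A1, with the validation targets (V1) `frameCorr k 1 ∘ 𝔥.deriv ∘ leftVelC 1 = d_c ∘ G_k`
(eq. (118) straight average + tree-contour potential) and (V2) `FrameIntertwinesTok` (3.114) as theorems.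

WHAT IS HERE (additive; every carrier and letter of files 3b∕3e′∕3f′ is used BYTE-IDENTICALLY; `BOfRecord` (20) is chart-free and has no twin).
* §1 (generic `P`) `FrameDatum P N k U₀` (fields `dom`, `dom_mem_nhds`, `map`, `inv`, `analyticAt_map`, `analyticAt_inv`, `map_mul_inv`, `map_bg`, `deriv`,
  `hasFDerivAt_map`); the framed average `avPrM 𝔥 V c := h(V)(c₋)·Ū^{ff}(V)(c)·h⁻¹(V)(c₊)` ((92) as a DEFINITION, placement as ✓`iterMh_gaugeSL`),
  `avPrM_bg`, `analyticAt_avPrM_apply`; the left velocity `leftVelC U₀ : X ↦ X·U₀` of the chart (15)∕(19); the frame correction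
  `frameCorr k U₀ μ c := L^{-k}·(Ū₀(c)μ(c₊)Ū₀(c)⋆ − μ(c₋))` (coarse covariant difference along `Ū₀ = iterM k ↑U₀`); the framed linearised averaging
  `qPrCplxOp k U₀ 𝔥 := qCplxOp k U₀ − frameCorr k U₀ ∘ 𝔥.deriv ∘ leftVelC U₀` («`Q^{pr} = q^{ff} − ∂∘Dh`», the derivative at `0` of
  `X ↦ logOver Ū₀ (avPrM 𝔥 (expOver U₀ X))`), `qPrCplxOp_of_deriv_eq_zero`.
* §2 (the record) `QprOfRecord F N k U₀ 𝔥 := bondFieldOut ∘ qPrCplxOp k U₀ 𝔥 ∘ bondFieldIn` in the slot type of `frakGOfRecord` (as `QOfRecord`);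
  the displayed token `FrameIntertwinesTok` ((3.114) for the pair `(Q^{pr}, QprimeOfRecord)`, the (g2) feed of lit ✓`h124'_RLatticeK`); the framed remainder
  `CprOfRecord F N K k Ω U₀ 𝔥 levB` (file 3e′'s `COfRecord` with `iterMh ↦ avPrM 𝔥`, `qCplxOp ↦ qPrCplxOp`), `CprOfRecord_apply` (`rfl`), `CprOfRecord_zero`
  (guarded `U₀`), `analyticAt_CprOfRecord` (Sect. G, on the window ∩ polydisc ∩ log-disc), and `CslprOfRecord := CprOfRecord ∘ slProjLit` (3f′'s slice letter).
* §1b∕§2∕§3 (vacuity guard) the FRAMELESS datum `FrameDatum.frameless k U₀` (`h = h⁻¹ = 1`, `Dh = 0`, window = everything) with `avPrM_frameless = iterMh k`,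
  `qPrCplxOp_frameless = qCplxOp k U₀`, `QprOfRecord_frameless = QOfRecord`, `CprOfRecord_frameless = COfRecord`, `CslprOfRecord_frameless = CslOfRecord` — a row keyed
  on an ARBITRARY datum says nothing the frame-free row did not; and the first-order calculus at the background: `FrameDatum.hasFDerivAt_inv` (`Dh⁻¹ = −Dh`),
  `mlog_hasFDerivAt_one` (`D log(1) = id`), `expOver_hasDerivAt_line`, `hasDerivAt_logChart_avPrM_line` (the velocity of the framed log-chart), `analyticAt_CprOfRecord_zero`.
* §4 KERNEL GUARD (second reader RR-2 READ 13 (α), hand-KLC, 2026-08-31): `hasFDerivAt_CprOfRecord_sub_COfRecord_zero` — under the guard `D(C^{pr} − C)(0) = 0` for EVERY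
  datum (the frame's velocity `∂∘Dh` is exactly what `Q^{pr}` removes; line derivatives + ℂ-differentiability + the weighted-sup identification, as the tangent files);
  `hasFDerivAt_CslprOfRecord_sub_CslOfRecord_zero`; hence `hasFDerivAt_CslprOfRecord_zero_iff : DC^{sl,pr}(0) = 0 ↔ C1Tok` (file 3g′'s displayed token, imported for the name).
The H₁ triple, `W^{pr}` and the Prop. 4 door letters at the framed slots are file A3 (`BgLettersPrOfRecord`).

HONEST: definitions, `rfl`-bookkeeping, `C^{pr}(0) = 0`, analyticity compositions and ONE first-order identity (`D(C^{pr} − C)(0) = 0`, chain rule); no bound, no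
positivity, no surjectivity asserted; (3.114) is a displayed `Prop`, not claimed; NO frame is constructed here (file A1); nothing of [B7]∕[B9]∕[B11]'s estimates proved;
COUNT∕K unchanged; finite `𝕋⁴` at fixed `ε`; nothing continuum ∕ OS ∕ Clay; no instance, no notation, no `sorry`.
-/


noncomputable section

open scoped Matrix Matrix.Norms.L2Operator InnerProductSpace ComplexConjugate Topology

namespace Literature.MathematicalPhysics.QuantumFieldTheory.Balaban1983to89.Node00

open T4Continuum BlockAveraging
open B4Sect5Torus (TSite)
open B9SectCLatticeCarrier (Bond)
open B9Eq311L2Pairing (WL2)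
open B11Eq103H1Complex (SiteL2K BondL2K covDerivL2K)
open B11Eq115Space (NegSize NegSup levWeight)
open B11Eq111FrakG (nabla115)
open NormedSpace (exp)
open MatrixLog (mlog mlog_one analyticAt_mlog exp_mlog)
open B15AveragingHolomorphic (iterMh loopMh loopMh_coeField coeField_avgFamily_eq_iterMh coeField_iter_eq_iterMh differentiableAt_iterMh)
open ExpMeanLog (expMeanLogSU)
open B15AveragingAnalytic (analyticAt_iterMh_of_polydisc)
open B15DeterminingSets (embIter)
open B13Contraction113 (QuadAnalytic)
open B11Prop6Scheme (Prop4Hyp)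

/-! ## §1. The frame datum and the framed averaging (generic lattice parameters) -/

section Generic

variable {P : Params} {N : ℕ} {k : ℕ}

variable (P N k) in
/-- ★★★ **A FRAME DATUM AT THE BACKGROUND `U₀`** — print's k-th order hierarchical frame `V ↦ (y ↦ h_k(V)(y))` of a complexified bond field at the
`k`-centres, RELATIVE to the background (trivial at `V = ↑U₀`: «R₀u_j = 1»), with its inverse, an analyticity WINDOW about `↑U₀` on which both are
ℂ-analytic (what the `Prop4Hyp`∕K-exp rows of the framed `C` consume), and its complex derivative at `↑U₀` as an explicit letter.  An INTERFACE: the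
record's own frame ([Balaban1985Averaging] (78)–(87) over the record's contours) is a separate construction inhabiting it (file A1); the op-norms of
`deriv` are read in the tree's `Matrix.Norms.L2Operator` scope, as every Node00 `Bg*` file.
[cite: Balaban1985Averaging, (78)–(81) p.30, (84)–(87) pp.30–31, (89) p.31, (92) p.31; Balaban1985BackgroundPropagators, (3.113) p.418; Balaban1985Variational, (21) p.281] -/
structure FrameDatum (U₀ : GaugeField P 0 (SU N)) where
  /-- the analyticity window of the frame (a set of complexified fine bond fields about `↑U₀`) -/
  dom : Set (PBond P 0 → Matrix (Fin N) (Fin N) ℂ)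
  /-- the window is a neighbourhood of the background -/
  dom_mem_nhds : dom ∈ 𝓝 (coeField U₀)
  /-- the frame map `V ↦ h(V)`, a matrix at every `k`-site -/
  map : (PBond P 0 → Matrix (Fin N) (Fin N) ℂ) → (Site P k → Matrix (Fin N) (Fin N) ℂ)
  /-- the inverse frame `V ↦ h(V)⁻¹` (an explicit letter of the construction, not `Ring.inverse`) -/
  inv : (PBond P 0 → Matrix (Fin N) (Fin N) ℂ) → (Site P k → Matrix (Fin N) (Fin N) ℂ)
  /-- `h` is ℂ-analytic on the window ([Balaban1985Variational] Sect. G: compositions of products, averages, `exp`, `log`) -/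
  analyticAt_map : ∀ V ∈ dom, AnalyticAt ℂ map V
  /-- `h⁻¹` is ℂ-analytic on the window -/
  analyticAt_inv : ∀ V ∈ dom, AnalyticAt ℂ inv V
  /-- `h · h⁻¹ = 1` on the window -/
  map_mul_inv : ∀ V ∈ dom, map V * inv V = 1
  /-- the frame of the unperturbed background is trivial («R₀u_j = 1») -/
  map_bg : map (coeField U₀) = 1
  /-- the complex derivative of `h` at the background, as an explicit letter -/
  deriv : (PBond P 0 → Matrix (Fin N) (Fin N) ℂ) →L[ℂ] (Site P k → Matrix (Fin N) (Fin N) ℂ)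
  /-- `deriv` IS the Fréchet derivative of `map` at `↑U₀` -/
  hasFDerivAt_map : HasFDerivAt map deriv (coeField U₀)

variable {U₀ : GaugeField P 0 (SU N)}

/-- ★★ **THE FRAMED `k`-th ORDER AVERAGE `Ū^{pr} := h • Ū^{ff}`** — [Balaban1985Averaging] (92) read as a DEFINITION over the datum: the un-framed
holomorphic iterate `iterMh k` ((88) ∕ [Balaban1987RG1] (0.21)) conjugated at the two end centres by the frame (placement as in `iterMh_gaugeSL`).
[cite: Balaban1985Averaging, (89) p.31, (92) p.31; Balaban1987RG1, (0.4) p.253, (0.21) p.256] -/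
def avPrM (𝔥 : FrameDatum P N k U₀) (V : PBond P 0 → Matrix (Fin N) (Fin N) ℂ) : PBond P k → Matrix (Fin N) (Fin N) ℂ :=
  fun c => 𝔥.map V c.src * iterMh k V c * 𝔥.inv V c.tgt

/-- Unfolding of `avPrM` (`rfl`). [cite: Balaban1985Averaging, (92) p.31 (bookkeeping)] -/
theorem avPrM_apply (𝔥 : FrameDatum P N k U₀) (V : PBond P 0 → Matrix (Fin N) (Fin N) ℂ) (c : PBond P k) :
    avPrM 𝔥 V c = 𝔥.map V c.src * iterMh k V c * 𝔥.inv V c.tgt := rfl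

/-- The inverse frame of the background is trivial. [cite: Balaban1985Variational, (21) p.281 (bookkeeping)] -/
theorem FrameDatum.inv_bg (𝔥 : FrameDatum P N k U₀) : 𝔥.inv (coeField U₀) = 1 := by
  have h := 𝔥.map_mul_inv _ (mem_of_mem_nhds 𝔥.dom_mem_nhds)
  rwa [𝔥.map_bg, one_mul] at h

/-- At the background the framed average is the un-framed one (`h(↑U₀) = 1`). [cite: Balaban1985Averaging, (92) p.31; Balaban1985Variational, (21) p.281] -/
theorem avPrM_bg (𝔥 : FrameDatum P N k U₀) : avPrM 𝔥 (coeField U₀) = iterMh k (coeField U₀) := by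
  funext c
  rw [avPrM_apply, 𝔥.map_bg, 𝔥.inv_bg, Pi.one_apply, Pi.one_apply, one_mul, mul_one]

/-- ★ **THE FRAMED AVERAGE IS ℂ-ANALYTIC ON THE WINDOW ∩ THE (0.4) POLYDISC** (bondwise: frame · holomorphic iterate · inverse frame).
[cite: Balaban1985Variational, Sect. G p.307, Prop. 9 p.309; Balaban1985Averaging, (92) p.31; Balaban1987RG1, (0.4) p.253] -/
theorem analyticAt_avPrM_apply (𝔥 : FrameDatum P N k U₀) {V : PBond P 0 → Matrix (Fin N) (Fin N) ℂ} (hV : V ∈ 𝔥.dom)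
    (hpoly : ∀ j, j < k → ∀ (c : PBond P (j + 1)) (i : Idx P), ‖loopMh (iterMh j V) c i - 1‖ < 1) (c : PBond P k) :
    AnalyticAt ℂ (fun W : PBond P 0 → Matrix (Fin N) (Fin N) ℂ => avPrM 𝔥 W c) V := by
  have hsrc : AnalyticAt ℂ (fun W : PBond P 0 → Matrix (Fin N) (Fin N) ℂ => 𝔥.map W c.src) V :=
    ((ContinuousLinearMap.proj (R := ℂ) (φ := fun _ : Site P k => Matrix (Fin N) (Fin N) ℂ) c.src).analyticAt _).comp (𝔥.analyticAt_map V hV)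
  have htgt : AnalyticAt ℂ (fun W : PBond P 0 → Matrix (Fin N) (Fin N) ℂ => 𝔥.inv W c.tgt) V :=
    ((ContinuousLinearMap.proj (R := ℂ) (φ := fun _ : Site P k => Matrix (Fin N) (Fin N) ℂ) c.tgt).analyticAt _).comp (𝔥.analyticAt_inv V hV)
  have hit : AnalyticAt ℂ (fun W : PBond P 0 → Matrix (Fin N) (Fin N) ℂ => iterMh k W c) V :=
    ((ContinuousLinearMap.proj (R := ℂ) (φ := fun _ : PBond P k => Matrix (Fin N) (Fin N) ℂ) c).analyticAt _).comp (analyticAt_iterMh_of_polydisc k hpoly)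
  exact (hsrc.mul hit).mul htgt

variable (U₀) in
/-- The left-velocity presentation `X ↦ (b ↦ X(b)·U₀(b))` of a tangent vector in the chart (15)∕(19) (complex-linear edition of file 3b's `leftVel`).
[cite: Balaban1985Variational, (15) p.280, (19) p.281 (bookkeeping)] -/
def leftVelC : (PBond P 0 → Matrix (Fin N) (Fin N) ℂ) →ₗ[ℂ] (PBond P 0 → Matrix (Fin N) (Fin N) ℂ) :=
  LinearMap.pi fun b => LinearMap.mulRight ℂ (U₀ b : Matrix (Fin N) (Fin N) ℂ) ∘ₗ LinearMap.proj b

/-- Unfolding of `leftVelC` (`rfl`). [cite: Balaban1985Variational, (19) p.281 (bookkeeping)] -/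
@[simp] theorem leftVelC_apply (X : PBond P 0 → Matrix (Fin N) (Fin N) ℂ) (b : PBond P 0) :
    leftVelC U₀ X b = X b * (U₀ b : Matrix (Fin N) (Fin N) ℂ) := rfl

variable (k U₀) in
/-- ★ **THE FRAME CORRECTION `μ ↦ ∂_{Ū₀} μ`** — the coarse covariant difference of a `k`-site field along the background average `Ū₀ = Ū^k(U₀)`,
in the `L^{-k}`-normalised right-trivialised coordinate of `qSkewOp`:
`(frameCorr μ)(c) = L^{-k}·(Ū₀(c)·μ(c₊)·Ū₀(c)⋆ − μ(c₋))`, `Ū₀ := iterM k ↑U₀` (file 3b's letter; `= ↑(Ū^kU₀)`, unitary, under the guard: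
`coeField_iter_eq_iterM`) — the shape of the right-hand side of ✓`qCplxOp_covGradM`, one level up.  It is MINUS the linearisation of
`c ↦ h(c₋)·Ū₀(c)·h(c₊)⁻¹` in the frame at `h = 1` (`δh = μ`), whence the sign in `qPrCplxOp`.
[cite: Balaban1985BackgroundPropagators, (3.114)–(3.115) p.418, (3.13) p.393; Balaban1985Averaging, (92) p.31] -/
def frameCorr : (Site P k → Matrix (Fin N) (Fin N) ℂ) →ₗ[ℂ] (PBond P k → Matrix (Fin N) (Fin N) ℂ) :=
  ((P.L : ℂ) ^ k)⁻¹ •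
    LinearMap.pi fun c : PBond P k =>
      LinearMap.mulRight ℂ (star (iterM k (coeField U₀) c)) ∘ₗ LinearMap.mulLeft ℂ (iterM k (coeField U₀) c) ∘ₗ
          LinearMap.proj (R := ℂ) (φ := fun _ : Site P k => Matrix (Fin N) (Fin N) ℂ) c.tgt -
        LinearMap.proj (R := ℂ) (φ := fun _ : Site P k => Matrix (Fin N) (Fin N) ℂ) c.src

/-- Unfolding of `frameCorr` at a coarse bond. [cite: Balaban1985BackgroundPropagators, (3.114) p.418 (bookkeeping)] -/
theorem frameCorr_apply (μ : Site P k → Matrix (Fin N) (Fin N) ℂ) (c : PBond P k) :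
    frameCorr k U₀ μ c =
      ((P.L : ℂ) ^ k)⁻¹ • (iterM k (coeField U₀) c * μ c.tgt * star (iterM k (coeField U₀) c) - μ c.src) := rfl

variable (k U₀) in
/-- ★★★ **THE FRAMED LINEARISED AVERAGING `Q^{pr}_k(U₀) = q^{ff} − ∂∘Dh`** — the `ℂ`-linear derivative at `A′ = 0` of the framed average `avPrM 𝔥` of the
chart field, in file 3b's log-coordinate: print's `Q_k(U₀)` of (3.13)–(3.15) built on the (3.113)-framed average (the frames divide the coarse pure
gauge channel out of the un-framed `qCplxOp`). [cite: Balaban1985BackgroundPropagators, (3.13)–(3.15) p.393, (3.113)–(3.115) p.418; Balaban1985Variational, (44) p.285] -/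
def qPrCplxOp (𝔥 : FrameDatum P N k U₀) : (PBond P 0 → Matrix (Fin N) (Fin N) ℂ) →ₗ[ℂ] (PBond P k → Matrix (Fin N) (Fin N) ℂ) :=
  qCplxOp k U₀ - frameCorr k U₀ ∘ₗ (𝔥.deriv : (PBond P 0 → Matrix (Fin N) (Fin N) ℂ) →ₗ[ℂ] (Site P k → Matrix (Fin N) (Fin N) ℂ)) ∘ₗ leftVelC U₀

/-- Unfolding of `qPrCplxOp` on a field. [cite: Balaban1985BackgroundPropagators, (3.13) p.393, (3.115) p.418 (bookkeeping)] -/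
theorem qPrCplxOp_apply (𝔥 : FrameDatum P N k U₀) (X : PBond P 0 → Matrix (Fin N) (Fin N) ℂ) :
    qPrCplxOp k U₀ 𝔥 X = qCplxOp k U₀ X - frameCorr k U₀ (𝔥.deriv (leftVelC U₀ X)) := rfl

/-- A datum with vanishing derivative frames nothing at first order: `Q^{pr} = q^{ff}`. [cite: Balaban1985BackgroundPropagators, (3.13) p.393 (bookkeeping)] -/
theorem qPrCplxOp_of_deriv_eq_zero (𝔥 : FrameDatum P N k U₀) (h0 : 𝔥.deriv = 0) : qPrCplxOp k U₀ 𝔥 = qCplxOp k U₀ := by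
  refine LinearMap.ext fun X => ?_
  rw [qPrCplxOp_apply, h0]
  simp

/-! ### §1b. The frameless datum (vacuity guard) and the first-order calculus of the framed chart at the background -/

variable (k U₀) in
/-- **THE FRAMELESS DATUM** — window = everything, `h = h⁻¹ = 1`, `Dh = 0`: over it every framed letter of this file IS the corresponding frame-free
letter of files 3b∕3e′∕3f′ (`avPrM_frameless`, `qPrCplxOp_frameless`, `QprOfRecord_frameless`, `CprOfRecord_frameless`, `CslprOfRecord_frameless`) — the
vacuity guard of the edition: a row keyed on an ARBITRARY datum says nothing the frame-free row did not; content enters only through the record's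
inhabitant (file A1). [cite: Balaban1985Averaging, (92) p.31; Balaban1985BackgroundPropagators, (3.13) p.393 (bookkeeping)] -/
def FrameDatum.frameless : FrameDatum P N k U₀ where
  dom := Set.univ
  dom_mem_nhds := Filter.univ_mem
  map := fun _ => 1
  inv := fun _ => 1
  analyticAt_map := fun _ _ => analyticAt_const
  analyticAt_inv := fun _ _ => analyticAt_const
  map_mul_inv := fun _ _ => mul_one 1
  map_bg := rfl
  deriv := 0
  hasFDerivAt_map := hasFDerivAt_const 1 _

/-- The frameless frame is `1`. [cite: Balaban1985Averaging, (92) p.31 (bookkeeping)] -/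
@[simp] theorem FrameDatum.frameless_map (V : PBond P 0 → Matrix (Fin N) (Fin N) ℂ) : (FrameDatum.frameless k U₀).map V = 1 := rfl

/-- The frameless inverse frame is `1`. [cite: Balaban1985Averaging, (92) p.31 (bookkeeping)] -/
@[simp] theorem FrameDatum.frameless_inv (V : PBond P 0 → Matrix (Fin N) (Fin N) ℂ) : (FrameDatum.frameless k U₀).inv V = 1 := rfl

/-- The frameless derivative letter is `0`. [cite: Balaban1985BackgroundPropagators, (3.13) p.393 (bookkeeping)] -/
@[simp] theorem FrameDatum.frameless_deriv : (FrameDatum.frameless k U₀).deriv = 0 := rfl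

/-- Over the frameless datum the framed average is the un-framed holomorphic iterate. [cite: Balaban1985Averaging, (92) p.31; Balaban1987RG1, (0.21) p.256] -/
theorem avPrM_frameless : avPrM (FrameDatum.frameless k U₀) = iterMh k := by
  funext V c
  rw [avPrM_apply, FrameDatum.frameless_map, FrameDatum.frameless_inv, Pi.one_apply, Pi.one_apply, one_mul, mul_one]

/-- Over the frameless datum `Q^{pr} = q^{ff}` (file 3b's `qCplxOp`). [cite: Balaban1985BackgroundPropagators, (3.13) p.393 (bookkeeping)] -/
theorem qPrCplxOp_frameless : qPrCplxOp k U₀ (FrameDatum.frameless k U₀) = qCplxOp k U₀ :=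
  qPrCplxOp_of_deriv_eq_zero _ rfl

/-- ★ **`D(h⁻¹)(↑U₀) = −Dh(↑U₀)`**: the inverse frame is differentiable at the background with derivative `−𝔥.deriv` (product rule on `h·h⁻¹ = 1` near `↑U₀`,
uniqueness of the derivative). [cite: Balaban1985Variational, Sect. G p.307; Balaban1985Averaging, (92) p.31 (bookkeeping)] -/
theorem FrameDatum.hasFDerivAt_inv (𝔥 : FrameDatum P N k U₀) : HasFDerivAt 𝔥.inv (-𝔥.deriv) (coeField U₀) := by
  have hmem : coeField U₀ ∈ 𝔥.dom := mem_of_mem_nhds 𝔥.dom_mem_nhds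
  have hinv : HasFDerivAt 𝔥.inv (fderiv ℂ 𝔥.inv (coeField U₀)) (coeField U₀) :=
    (𝔥.analyticAt_inv _ hmem).differentiableAt.hasFDerivAt
  have hprod := 𝔥.hasFDerivAt_map.mul' hinv
  have hone : HasFDerivAt (𝔥.map * 𝔥.inv)
      (0 : (PBond P 0 → Matrix (Fin N) (Fin N) ℂ) →L[ℂ] (Site P k → Matrix (Fin N) (Fin N) ℂ)) (coeField U₀) := by
    refine (hasFDerivAt_const (1 : Site P k → Matrix (Fin N) (Fin N) ℂ) (coeField U₀)).congr_of_eventuallyEq ?_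
    filter_upwards [𝔥.dom_mem_nhds] with V hV
    exact 𝔥.map_mul_inv V hV
  have huniq := hprod.unique hone
  rw [𝔥.map_bg, 𝔥.inv_bg, one_smul, MulOpposite.op_one, one_smul] at huniq
  rwa [eq_neg_of_add_eq_zero_left huniq] at hinv

/-- **`D log(1) = id`** on `M_N(ℂ)` (the series logarithm inverts `exp` near `1` and `D exp(0) = id`; Node00 edition of the Summits-side lemma of the tangent files).
[cite: Balaban1985Averaging, (21) p.21] -/
theorem mlog_hasFDerivAt_one :
    HasFDerivAt (mlog : Matrix (Fin N) (Fin N) ℂ → Matrix (Fin N) (Fin N) ℂ) (ContinuousLinearMap.id ℂ (Matrix (Fin N) (Fin N) ℂ)) 1 := by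
  have hd : DifferentiableAt ℂ (mlog : Matrix (Fin N) (Fin N) ℂ → Matrix (Fin N) (Fin N) ℂ) 1 := (analyticAt_mlog (by simp)).differentiableAt
  set L := fderiv ℂ (mlog : Matrix (Fin N) (Fin N) ℂ → Matrix (Fin N) (Fin N) ℂ) 1 with hL
  have hm : HasFDerivAt (mlog : Matrix (Fin N) (Fin N) ℂ → Matrix (Fin N) (Fin N) ℂ) L 1 := hd.hasFDerivAt
  have he : HasFDerivAt (exp : Matrix (Fin N) (Fin N) ℂ → Matrix (Fin N) (Fin N) ℂ) (1 : Matrix (Fin N) (Fin N) ℂ →L[ℂ] Matrix (Fin N) (Fin N) ℂ)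
      (mlog (1 : Matrix (Fin N) (Fin N) ℂ)) := by
    rw [mlog_one]; exact hasFDerivAt_exp_zero
  have hcomp : HasFDerivAt (fun X : Matrix (Fin N) (Fin N) ℂ => exp (mlog X)) ((1 : Matrix (Fin N) (Fin N) ℂ →L[ℂ] Matrix (Fin N) (Fin N) ℂ).comp L) 1 :=
    he.comp 1 hm
  have hev : (fun X : Matrix (Fin N) (Fin N) ℂ => exp (mlog X)) =ᶠ[𝓝 1] id := by
    have hopen : IsOpen {X : Matrix (Fin N) (Fin N) ℂ | ‖X - 1‖ < 1} :=
      isOpen_lt (continuous_norm.comp (continuous_id.sub continuous_const)) continuous_const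
    filter_upwards [hopen.mem_nhds (by simp : (1 : Matrix (Fin N) (Fin N) ℂ) ∈ {X : Matrix (Fin N) (Fin N) ℂ | ‖X - 1‖ < 1})] with X hX
    exact exp_mlog hX
  have hid : HasFDerivAt (id : Matrix (Fin N) (Fin N) ℂ → Matrix (Fin N) (Fin N) ℂ) ((1 : Matrix (Fin N) (Fin N) ℂ →L[ℂ] Matrix (Fin N) (Fin N) ℂ).comp L) 1 :=
    hcomp.congr_of_eventuallyEq hev.symm
  have huniq : (1 : Matrix (Fin N) (Fin N) ℂ →L[ℂ] Matrix (Fin N) (Fin N) ℂ).comp L = ContinuousLinearMap.id ℂ (Matrix (Fin N) (Fin N) ℂ) :=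
    hid.unique (hasFDerivAt_id 1)
  rw [ContinuousLinearMap.one_def, ContinuousLinearMap.id_comp] at huniq
  rwa [huniq] at hm

variable (U₀) in
/-- The chart curve `t ↦ e^{itY}·U₀` has bond-wise velocity `(iY_b)·U₀(b)` at `t = 0`. [cite: Balaban1985Variational, (15) p.280, (18)–(19) p.281 (bookkeeping)] -/
theorem expOver_hasDerivAt_line (Y : PBond P 0 → Matrix (Fin N) (Fin N) ℂ) :
    HasDerivAt (fun t : ℂ => expOver U₀ (t • Y)) (fun b => (Complex.I • Y b) * (U₀ b : Matrix (Fin N) (Fin N) ℂ)) 0 := by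
  refine hasDerivAt_pi.2 fun b => ?_
  have hfun : (fun t : ℂ => expOver U₀ (t • Y) b) = fun t : ℂ => exp (t • (Complex.I • Y b)) * (U₀ b : Matrix (Fin N) (Fin N) ℂ) := by
    funext t
    rw [expOver_apply, Pi.smul_apply, smul_comm]
  rw [hfun]
  have h := (hasDerivAt_exp_smul_const' (𝕂 := ℂ) (Complex.I • Y b) (0 : ℂ)).mul_const (U₀ b : Matrix (Fin N) (Fin N) ℂ)
  simpa using h

section GenericDeriv

variable [NeZero N]

variable (U₀) in
/-- ★★ **THE LINE DERIVATIVE OF THE FRAMED LOG-AVERAGED CHART**: under the guard of `U₀` below `k`, for every direction `Y` and coarse bond `c`,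
`d∕dt|₀ (1/i)·log( Ū^{pr}(e^{itY}U₀)(c) · Ū^k(U₀)(c)⋆ ) = (1/i)·D(Ū^k_h)(↑U₀)[iY·U₀](c)·Ū^k(U₀)(c)⋆ + (1/i)·( Dh[iY·U₀](c₋) − Ū^k(U₀)(c)·Dh[iY·U₀](c₊)·Ū^k(U₀)(c)⋆ )`
— the un-framed velocity plus the frame's: chain rule through `D exp(0)`, the product `h(c₋)·Ū^k_h·h⁻¹(c₊)` (`Dh⁻¹ = −Dh`, `h(↑U₀) = 1`), and `D log(1) = id`.
[cite: Balaban1985Averaging, (92) p.31; Balaban1985Variational, (20) p.281, (44) p.285; Balaban1985BackgroundPropagators, (3.113) p.418; Balaban1987RG1, (0.4) p.253] -/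
theorem hasDerivAt_logChart_avPrM_line (𝔥 : FrameDatum P N k U₀) (h : SmallBelow (fun j => blockAvg (P := P) (j := j) expMeanLogSU) k U₀)
    (Y : PBond P 0 → Matrix (Fin N) (Fin N) ℂ) (c : PBond P k) :
    HasDerivAt (fun t : ℂ => logOver (coeField (Averaging.iter (fun j => blockAvg (P := P) (j := j) expMeanLogSU) k U₀)) (avPrM 𝔥 (expOver U₀ (t • Y))) c)
      ((Complex.I⁻¹ : ℂ) •
          (fderiv ℂ (iterMh k : (PBond P 0 → Matrix (Fin N) (Fin N) ℂ) → PBond P k → Matrix (Fin N) (Fin N) ℂ) (coeField U₀)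
              (fun b => (Complex.I • Y b) * (U₀ b : Matrix (Fin N) (Fin N) ℂ)) c *
            star ((Averaging.iter (fun j => blockAvg (P := P) (j := j) expMeanLogSU) k U₀ c : SU N) : Matrix (Fin N) (Fin N) ℂ)) +
        (Complex.I⁻¹ : ℂ) •
          (𝔥.deriv (fun b => (Complex.I • Y b) * (U₀ b : Matrix (Fin N) (Fin N) ℂ)) c.src -
            ((Averaging.iter (fun j => blockAvg (P := P) (j := j) expMeanLogSU) k U₀ c : SU N) : Matrix (Fin N) (Fin N) ℂ) *
                𝔥.deriv (fun b => (Complex.I • Y b) * (U₀ b : Matrix (Fin N) (Fin N) ℂ)) c.tgt *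
              star ((Averaging.iter (fun j => blockAvg (P := P) (j := j) expMeanLogSU) k U₀ c : SU N) : Matrix (Fin N) (Fin N) ℂ))) 0 := by
  set W : PBond P k → Matrix (Fin N) (Fin N) ℂ := coeField (Averaging.iter (fun j => blockAvg (P := P) (j := j) expMeanLogSU) k U₀) with hW
  set D := fderiv ℂ (iterMh k : (PBond P 0 → Matrix (Fin N) (Fin N) ℂ) → PBond P k → Matrix (Fin N) (Fin N) ℂ) (coeField U₀) with hDdef
  have hWc : W c = ((Averaging.iter (fun j => blockAvg (P := P) (j := j) expMeanLogSU) k U₀ c : SU N) : Matrix (Fin N) (Fin N) ℂ) := rfl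
  have hWu : W c * star (W c) = 1 := by rw [hWc]; exact coe_mul_star_coe_SU _
  have h0 : expOver U₀ ((0 : ℂ) • Y) = coeField U₀ := by rw [zero_smul, expOver_zero]
  -- the chart curve and the three curves it drives: frame, holomorphic iterate, inverse frame
  have hχ := expOver_hasDerivAt_line U₀ Y
  have hm : HasDerivAt (fun t : ℂ => 𝔥.map (expOver U₀ (t • Y))) (𝔥.deriv (fun b => (Complex.I • Y b) * (U₀ b : Matrix (Fin N) (Fin N) ℂ))) 0 := by
    have hF : HasFDerivAt 𝔥.map 𝔥.deriv (expOver U₀ ((0 : ℂ) • Y)) := by rw [h0]; exact 𝔥.hasFDerivAt_map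
    exact hF.comp_hasDerivAt (0 : ℂ) hχ
  have hn : HasDerivAt (fun t : ℂ => 𝔥.inv (expOver U₀ (t • Y))) ((-𝔥.deriv) (fun b => (Complex.I • Y b) * (U₀ b : Matrix (Fin N) (Fin N) ℂ))) 0 := by
    have hF : HasFDerivAt 𝔥.inv (-𝔥.deriv) (expOver U₀ ((0 : ℂ) • Y)) := by rw [h0]; exact 𝔥.hasFDerivAt_inv
    exact hF.comp_hasDerivAt (0 : ℂ) hχ
  have hZ : HasDerivAt (fun t : ℂ => iterMh k (expOver U₀ (t • Y))) (D (fun b => (Complex.I • Y b) * (U₀ b : Matrix (Fin N) (Fin N) ℂ))) 0 := by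
    have hF : HasFDerivAt (iterMh k : (PBond P 0 → Matrix (Fin N) (Fin N) ℂ) → PBond P k → Matrix (Fin N) (Fin N) ℂ) D (expOver U₀ ((0 : ℂ) • Y)) := by
      rw [h0]; exact (differentiableAt_iterMh k h).hasFDerivAt
    exact hF.comp_hasDerivAt (0 : ℂ) hχ
  have hP := ((((hasDerivAt_pi.1 hm) c.src).mul ((hasDerivAt_pi.1 hZ) c)).mul ((hasDerivAt_pi.1 hn) c.tgt)).mul_const (star (W c))
  -- values at `t = 0`
  have hm0 : 𝔥.map (expOver U₀ ((0 : ℂ) • Y)) c.src = 1 := by rw [h0, 𝔥.map_bg, Pi.one_apply]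
  have hn0 : 𝔥.inv (expOver U₀ ((0 : ℂ) • Y)) c.tgt = 1 := by rw [h0, 𝔥.inv_bg, Pi.one_apply]
  have hZ0 : iterMh k (expOver U₀ ((0 : ℂ) • Y)) c = W c := by rw [h0, ← coeField_iter_eq_iterMh k h]
  have hpt : 𝔥.map (expOver U₀ ((0 : ℂ) • Y)) c.src * iterMh k (expOver U₀ ((0 : ℂ) • Y)) c * 𝔥.inv (expOver U₀ ((0 : ℂ) • Y)) c.tgt * star (W c) = 1 := by
    rw [hm0, hn0, hZ0, one_mul, mul_one, hWu]
  have hlog : HasFDerivAt (mlog : Matrix (Fin N) (Fin N) ℂ → Matrix (Fin N) (Fin N) ℂ) (ContinuousLinearMap.id ℂ (Matrix (Fin N) (Fin N) ℂ))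
      (𝔥.map (expOver U₀ ((0 : ℂ) • Y)) c.src * iterMh k (expOver U₀ ((0 : ℂ) • Y)) c * 𝔥.inv (expOver U₀ ((0 : ℂ) • Y)) c.tgt * star (W c)) := by
    rw [hpt]; exact mlog_hasFDerivAt_one
  have hcomp := (hlog.comp_hasDerivAt (0 : ℂ) hP).const_smul (Complex.I⁻¹ : ℂ)
  have hfun : (fun t : ℂ => logOver W (avPrM 𝔥 (expOver U₀ (t • Y))) c)
      = fun t : ℂ => (Complex.I⁻¹ : ℂ) •
          mlog (𝔥.map (expOver U₀ (t • Y)) c.src * iterMh k (expOver U₀ (t • Y)) c * 𝔥.inv (expOver U₀ (t • Y)) c.tgt * star (W c)) := by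
    funext t
    rw [logOver_apply, avPrM_apply]
  rw [hfun]
  refine hcomp.congr_deriv ?_
  simp only [Pi.mul_apply]
  rw [← hWc, ContinuousLinearMap.id_apply, hm0, hn0, hZ0, _root_.neg_apply, Pi.neg_apply, one_mul, mul_one, one_mul, ← smul_add]
  congr 1
  rw [add_mul, add_mul, mul_assoc (𝔥.deriv _ c.src), hWu, mul_one]
  noncomm_ring

end GenericDeriv

end Generic

/-! ## §2. At the record: `Q^{pr}` between the lit carriers and the (3.114) token -/

section RecordQ

variable (F : T4Family) (N : ℕ) {K : ℕ} (k : ℕ) (U₀ : GaugeField (F.P K) 0 (SU N))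

/-- ★★★ **`Q^{pr} = Q^{pr}_k(U₀)` OF RECORD IN THE SLOT TYPE OF `frakGOfRecord`** — `qPrCplxOp k U₀ 𝔥` read between the lit carriers, exactly as
file 3b's `QOfRecord` reads `qCplxOp`. [cite: Balaban1985BackgroundPropagators, (3.13)–(3.16) p.393, (3.113) p.418; Balaban1985Variational, (44) p.285, (100) p.293] -/
def QprOfRecord (𝔥 : FrameDatum (F.P K) N k U₀) :
    BondL2K ℂ (F.P K).d (fun _ => (F.P K).sitesPerDir 0) (c0Rec F K k) (WRec N) →ₗ[ℂ] WL2 ℂ (wBRec F K k) (WRec N) :=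
  bondFieldOut F N k ∘ₗ qPrCplxOp k U₀ 𝔥 ∘ₗ bondFieldIn F N k

/-- Unfolding of `QprOfRecord`. [cite: Balaban1985BackgroundPropagators, (3.13) p.393 (bookkeeping)] -/
theorem QprOfRecord_apply (𝔥 : FrameDatum (F.P K) N k U₀)
    (A : BondL2K ℂ (F.P K).d (fun _ => (F.P K).sitesPerDir 0) (c0Rec F K k) (WRec N)) (c : PBond (F.P K) k) :
    WL2.equiv ℂ _ _ (QprOfRecord F N k U₀ 𝔥 A) c = (phiRec N).symm (qPrCplxOp k U₀ 𝔥 (bondFieldIn F N k A) c) := rfl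

/-- `Q^{pr}` of a datum with vanishing derivative is file 3b's `QOfRecord`. [cite: Balaban1985BackgroundPropagators, (3.13) p.393 (bookkeeping)] -/
theorem QprOfRecord_of_deriv_eq_zero (𝔥 : FrameDatum (F.P K) N k U₀) (h0 : 𝔥.deriv = 0) :
    QprOfRecord F N k U₀ 𝔥 = QOfRecord F N k U₀ := by
  rw [QprOfRecord, qPrCplxOp_of_deriv_eq_zero 𝔥 h0]; rfl

/-- Over the frameless datum `Q^{pr}` of record is file 3b's `QOfRecord`. [cite: Balaban1985BackgroundPropagators, (3.13) p.393 (bookkeeping)] -/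
theorem QprOfRecord_frameless : QprOfRecord F N k U₀ (FrameDatum.frameless k U₀) = QOfRecord F N k U₀ :=
  QprOfRecord_of_deriv_eq_zero F N k U₀ _ rfl

variable [NeZero N]

/-- ★ **(3.114) AS A DISPLAYED TOKEN — `Q^{pr}` INTERTWINES THE COVARIANT DERIVATIVE WITH PRINT'S BLOCK-MEAN SITE LETTER `Q′ = QprimeOfRecord`**:
«`(Q̄ D λ)(c) = (Q′λ)(c₊) − (Q′λ)(c₋)`» — the (g2)∕(1.55) feed of lit `h124'_RLatticeK` for the pair `(Q^{pr}, Q′_block)`, in the shape of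
✓`qCplxOp_covGradM`.  A `Prop`; proved for the record's inhabitant in file A1, not asserted here.
[cite: Balaban1985BackgroundPropagators, (3.114)–(3.115) p.418, (3.18)–(3.19) p.393; Balaban1984PropagatorsI, (1.55) p.27 (shape)] -/
def FrameIntertwinesTok (𝔥 : FrameDatum (F.P K) N k U₀) : Prop :=
  ∀ (lam : Site (F.P K) 0 → Matrix (Fin N) (Fin N) ℂ) (c : PBond (F.P K) k),
    qPrCplxOp k U₀ 𝔥 (fun b : PBond (F.P K) 0 => (U₀ b : Matrix (Fin N) (Fin N) ℂ) * lam b.tgt * star (U₀ b : Matrix (Fin N) (Fin N) ℂ) - lam b.src) c =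
      (((F.P K).L : ℂ) ^ k)⁻¹ •
        (((Averaging.iter (avOfRecord F N K) k U₀ c : SU N) : Matrix (Fin N) (Fin N) ℂ) * siteAvgIter (avOfRecord F N K) U₀ k lam c.tgt *
            star ((Averaging.iter (avOfRecord F N K) k U₀ c : SU N) : Matrix (Fin N) (Fin N) ℂ) -
          siteAvgIter (avOfRecord F N K) U₀ k lam c.src)

end RecordQ

/-! ## §3. The framed remainder `C^{pr}` and its slice edition `C^{sl,pr}` -/

section Record

variable (F : T4Family) (N : ℕ) [NeZero N] (K : ℕ) (k : ℕ) (Ω : ℕ → Set (Site (F.P K) 0)) (U₀ : GaugeField (F.P K) 0 (SU N))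

/-- ★★ **THE FRAMED NONLINEAR CONSTRAINT LETTER `C^{pr}_k` OF (44) AT THE RECORD** — file 3e′'s `COfRecord` with the un-framed holomorphic iterate replaced
by the framed average `avPrM 𝔥` and the linear part by `qPrCplxOp k U₀ 𝔥`; the base `Ū^k(U₀)` of the log-coordinate is unchanged (`𝔥.map_bg = 1`).
[cite: Balaban1985Variational, (44) p.285, (49)–(50) p.285, (20) p.281; Balaban1985BackgroundPropagators, (3.113) p.418; Balaban1985Averaging, (92) p.31] -/
def CprOfRecord (𝔥 : FrameDatum (F.P K) N k U₀) (levB : PBond (F.P K) k → ℕ) :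
    Space115Lit F N K k Ω U₀ → NegSize (F.L : ℝ) ((F.P K).eta k) levB 0 (Matrix (Fin N) (Fin N) ℂ) :=
  fun A => (NegSup.equiv _ _).symm
    (logOver (coeField (Averaging.iter (avOfRecord F N K) k U₀)) (avPrM 𝔥 (expOver U₀ ((((F.P K).eta k : ℝ) : ℂ) • evLit F N K k Ω U₀ A)))
      - qPrCplxOp k U₀ 𝔥 (evLit F N K k Ω U₀ A))

/-- Unfolding of `CprOfRecord` at a bond (`rfl`). [cite: Balaban1985Variational, (44) p.285 (bookkeeping)] -/
theorem CprOfRecord_apply (𝔥 : FrameDatum (F.P K) N k U₀) (levB : PBond (F.P K) k → ℕ) (A : Space115Lit F N K k Ω U₀) (c : PBond (F.P K) k) :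
    NegSup.equiv _ _ (CprOfRecord F N K k Ω U₀ 𝔥 levB A) c =
      (Complex.I⁻¹ : ℂ) • mlog (avPrM 𝔥 (expOver U₀ ((((F.P K).eta k : ℝ) : ℂ) • evLit F N K k Ω U₀ A)) c
          * star (Averaging.iter (avOfRecord F N K) k U₀ c : Matrix (Fin N) (Fin N) ℂ))
        - qPrCplxOp k U₀ 𝔥 (evLit F N K k Ω U₀ A) c := rfl

/-- ★ **`C^{pr}(0) = 0`** under the small-field guard of `U₀` below `k` (the framed average of `↑U₀` is `↑(Ū^kU₀)`, unitary; `log 1 = 0`; `Q^{pr}0 = 0`).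
[cite: Balaban1985Variational, (44) p.285; Balaban1985Averaging, (92) p.31; Balaban1987RG1, (0.4) p.253] -/
theorem CprOfRecord_zero (𝔥 : FrameDatum (F.P K) N k U₀) (levB : PBond (F.P K) k → ℕ) (hU₀ : SmallBelow (avOfRecord F N K) k U₀) :
    CprOfRecord F N K k Ω U₀ 𝔥 levB 0 = 0 := by
  refine (NegSup.equiv _ _).injective (funext fun c => ?_)
  simp only [CprOfRecord_apply, map_zero, smul_zero, expOver_zero, avPrM_bg, iterMh_coeField_of_smallBelow F N k U₀ hU₀, coeField_apply,
    coe_mul_star_coe_SU, mlog_one, sub_zero, NegSup.equiv_zero, Pi.zero_apply]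

/-- ★★ **`C^{pr}` IS ℂ-ANALYTIC** at every `A′` whose chart field lies in the frame's window, has its (0.4) loop matrices below `k` in the polydisc, and whose
framed relative average lies in the log-disc — file 3e′'s `analyticAt_COfRecord` with the frame's analyticity (the datum's `analyticAt_map`∕`_inv`) spliced in.
[cite: Balaban1985Variational, Sect. G p.307, Prop. 9 p.309, (44) p.285; Balaban1985Averaging, (92) p.31; Balaban1987RG1, (0.4) p.253] -/
theorem analyticAt_CprOfRecord [Fact (0 < (F.L : ℝ))] [Fact (0 < (F.P K).eta k)] (𝔥 : FrameDatum (F.P K) N k U₀) (levB : PBond (F.P K) k → ℕ)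
    (A : Space115Lit F N K k Ω U₀) (hdom : expOver U₀ ((((F.P K).eta k : ℝ) : ℂ) • evLit F N K k Ω U₀ A) ∈ 𝔥.dom)
    (hpoly : ∀ j, j < k → ∀ (c : PBond (F.P K) (j + 1)) (i : Idx (F.P K)),
      ‖loopMh (iterMh j (expOver U₀ ((((F.P K).eta k : ℝ) : ℂ) • evLit F N K k Ω U₀ A))) c i - 1‖ < 1)
    (hlog : ∀ c : PBond (F.P K) k,
      ‖avPrM 𝔥 (expOver U₀ ((((F.P K).eta k : ℝ) : ℂ) • evLit F N K k Ω U₀ A)) c * star (Averaging.iter (avOfRecord F N K) k U₀ c : Matrix (Fin N) (Fin N) ℂ) - 1‖ < 1) :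
    AnalyticAt ℂ (CprOfRecord F N K k Ω U₀ 𝔥 levB) A := by
  have hev : AnalyticAt ℂ (fun Y : Space115Lit F N K k Ω U₀ => evLit F N K k Ω U₀ Y) A :=
    (LinearMap.toContinuousLinearMap (evLit F N K k Ω U₀)).analyticAt A
  have hX : AnalyticAt ℂ (fun Y : Space115Lit F N K k Ω U₀ => (((F.P K).eta k : ℝ) : ℂ) • evLit F N K k Ω U₀ Y) A := hev.fun_const_smul
  have hchart : AnalyticAt ℂ (fun Y : Space115Lit F N K k Ω U₀ => expOver U₀ ((((F.P K).eta k : ℝ) : ℂ) • evLit F N K k Ω U₀ Y)) A :=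
    (analyticAt_expOver U₀ _).comp_of_eq hX rfl
  have hav : ∀ c : PBond (F.P K) k,
      AnalyticAt ℂ (fun Y : Space115Lit F N K k Ω U₀ => avPrM 𝔥 (expOver U₀ ((((F.P K).eta k : ℝ) : ℂ) • evLit F N K k Ω U₀ Y)) c) A := fun c =>
    (analyticAt_avPrM_apply 𝔥 hdom hpoly c).comp_of_eq hchart rfl
  have hav' : AnalyticAt ℂ (fun Y : Space115Lit F N K k Ω U₀ => fun c : PBond (F.P K) k =>
      avPrM 𝔥 (expOver U₀ ((((F.P K).eta k : ℝ) : ℂ) • evLit F N K k Ω U₀ Y)) c) A := analyticAt_pi_iff.2 hav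
  have hlin : AnalyticAt ℂ (fun Y : Space115Lit F N K k Ω U₀ => qPrCplxOp k U₀ 𝔥 (evLit F N K k Ω U₀ Y)) A :=
    (LinearMap.toContinuousLinearMap (qPrCplxOp k U₀ 𝔥 ∘ₗ evLit F N K k Ω U₀)).analyticAt A
  have hg : AnalyticAt ℂ (fun Y : Space115Lit F N K k Ω U₀ =>
      logOver (coeField (Averaging.iter (avOfRecord F N K) k U₀)) (avPrM 𝔥 (expOver U₀ ((((F.P K).eta k : ℝ) : ℂ) • evLit F N K k Ω U₀ Y)))
        - qPrCplxOp k U₀ 𝔥 (evLit F N K k Ω U₀ Y)) A := by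
    refine AnalyticAt.fun_sub (analyticAt_pi_iff.2 fun c => ?_) hlin
    exact (analyticAt_logOver_apply (coeField (Averaging.iter (avOfRecord F N K) k U₀)) c (hlog c)).comp_of_eq hav' rfl
  exact ((NegSup.continuousLinearEquiv ℂ (V := Matrix (Fin N) (Fin N) ℂ) (levWeight (F.L : ℝ) ((F.P K).eta k) levB 0)).symm.analyticAt _).comp hg

/-- ★ **`C^{pr}` ON THE SLICE: `C^{sl,pr}(A′) := C^{pr}(P A′)`** (file 3f′'s `CslOfRecord` verbatim over the framed letter). [cite: Balaban1985Variational, (44) p.285, (51) p.286] -/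
def CslprOfRecord [Fact (0 < (F.L : ℝ))] [Fact (0 < (F.P K).eta k)] (𝔥 : FrameDatum (F.P K) N k U₀) (levB : PBond (F.P K) k → ℕ) :
    Space115Lit F N K k Ω U₀ → NegSize (F.L : ℝ) ((F.P K).eta k) levB 0 (Matrix (Fin N) (Fin N) ℂ) :=
  fun A => CprOfRecord F N K k Ω U₀ 𝔥 levB (slProjLit F N K k Ω U₀ A)

/-- Unfolding (`rfl`). [cite: Balaban1985Variational, (44) p.285 (bookkeeping)] -/
theorem CslprOfRecord_apply [Fact (0 < (F.L : ℝ))] [Fact (0 < (F.P K).eta k)] (𝔥 : FrameDatum (F.P K) N k U₀) (levB : PBond (F.P K) k → ℕ)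
    (A : Space115Lit F N K k Ω U₀) :
    CslprOfRecord F N K k Ω U₀ 𝔥 levB A = CprOfRecord F N K k Ω U₀ 𝔥 levB (slProjLit F N K k Ω U₀ A) := rfl

/-- Over the frameless datum `C^{pr}` is file 3e′'s `COfRecord`. [cite: Balaban1985Variational, (44) p.285 (bookkeeping)] -/
theorem CprOfRecord_frameless (levB : PBond (F.P K) k → ℕ) :
    CprOfRecord F N K k Ω U₀ (FrameDatum.frameless k U₀) levB = COfRecord F N K k Ω U₀ levB := by
  funext A
  simp only [CprOfRecord, COfRecord, avPrM_frameless, qPrCplxOp_frameless]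

/-- Over the frameless datum `C^{sl,pr}` is file 3f′'s `CslOfRecord`. [cite: Balaban1985Variational, (44) p.285, (51) p.286 (bookkeeping)] -/
theorem CslprOfRecord_frameless [Fact (0 < (F.L : ℝ))] [Fact (0 < (F.P K).eta k)] (levB : PBond (F.P K) k → ℕ) :
    CslprOfRecord F N K k Ω U₀ (FrameDatum.frameless k U₀) levB = CslOfRecord F N K k Ω U₀ levB := by
  funext A
  rw [CslprOfRecord_apply, CslOfRecord_apply, CprOfRecord_frameless]

/-- ★ **`C^{pr}` IS ℂ-ANALYTIC AT `A′ = 0`** under the guard of `U₀` below `k` (the chart field of `0` is `↑U₀`: in the window, on the polydisc by the guard,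
and at the centre of the log-disc). [cite: Balaban1985Variational, Sect. G p.307, (51)–(53) p.286; Balaban1985Averaging, (92) p.31; Balaban1987RG1, (0.4) p.253] -/
theorem analyticAt_CprOfRecord_zero [Fact (0 < (F.L : ℝ))] [Fact (0 < (F.P K).eta k)] (𝔥 : FrameDatum (F.P K) N k U₀) (levB : PBond (F.P K) k → ℕ)
    (hU₀ : SmallBelow (avOfRecord F N K) k U₀) : AnalyticAt ℂ (CprOfRecord F N K k Ω U₀ 𝔥 levB) 0 := by
  refine analyticAt_CprOfRecord F N K k Ω U₀ 𝔥 levB 0 ?_ (fun j hj c i => ?_) (fun c => ?_)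
  · rw [expOver_evLit_zero]
    exact mem_of_mem_nhds 𝔥.dom_mem_nhds
  · have hsb : SmallBelow (avOfRecord F N K) j U₀ := fun j' hj' c' => hU₀ j' (lt_trans hj' hj) c'
    rw [expOver_evLit_zero, iterMh_coeField_of_smallBelow F N j U₀ hsb, loopMh_coeField]
    exact norm_loopM_coeField_sub_one_lt_one _ c (hU₀ j hj c) i
  · rw [expOver_evLit_zero, avPrM_bg, iterMh_coeField_of_smallBelow F N k U₀ hU₀, coeField_apply, coe_mul_star_coe_SU, sub_self, norm_zero]
    exact one_pos

/-! ## §4. KERNEL GUARD — the framed remainder has the SAME linearisation at `0` as the frame-free one: `D(C^{pr} − C)(0) = 0` -/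

omit [NeZero N] in
/-- `η_k = L^{-k}` read in `ℂ`: the record's spacing IS `frameCorr`'s normalisation. [cite: Balaban1985Variational, (9)–(10) p.279; Balaban1987RG1, (1.2) p.260] -/
theorem eta_cast_eq_inv_L_pow : ((((F.P K).eta k : ℝ) : ℂ)) = (((F.P K).L : ℂ) ^ k)⁻¹ := by
  rw [Params.eta, Complex.ofReal_pow, Complex.ofReal_inv, Complex.ofReal_natCast, inv_pow]

/-- ★★ **THE LINE DERIVATIVES OF `C^{pr} − C` AT `0` VANISH**: under the guard of `U₀` below `k`, for every `A′` and coarse bond `c`,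
`d∕dt|₀ (C^{pr} − C)(t·A′)(c) = (1/i)( Dh[iηY·U₀](c₋) − Ū₀(c)·Dh[iηY·U₀](c₊)·Ū₀(c)⋆ ) + L^{-k}( Ū₀(c)·Dh[Y·U₀](c₊)·Ū₀(c)⋆ − Dh[Y·U₀](c₋) ) = 0`, `Y = ev A′`,
`η = L^{-k}` — the frame's velocity (§1b) against `frameCorr ∘ 𝔥.deriv ∘ leftVelC` (the correction `qPrCplxOp` subtracts); the un-framed velocities cancel identically.
[cite: Balaban1985Variational, (44) p.285, (20) p.281; Balaban1985BackgroundPropagators, (3.113)–(3.115) p.418; Balaban1985Averaging, (92) p.31] -/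
theorem hasDerivAt_CprOfRecord_sub_COfRecord_line_zero [Fact (0 < (F.L : ℝ))] [Fact (0 < (F.P K).eta k)] (𝔥 : FrameDatum (F.P K) N k U₀)
    (levB : PBond (F.P K) k → ℕ) (hU₀ : SmallBelow (avOfRecord F N K) k U₀) (A : Space115Lit F N K k Ω U₀) (c : PBond (F.P K) k) :
    HasDerivAt (fun t : ℂ => NegSup.equiv _ _ (CprOfRecord F N K k Ω U₀ 𝔥 levB (t • A) - COfRecord F N K k Ω U₀ levB (t • A)) c) 0 0 := by
  set Y : PBond (F.P K) 0 → Matrix (Fin N) (Fin N) ℂ := evLit F N K k Ω U₀ A with hYdef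
  set η : ℂ := ((((F.P K).eta k : ℝ) : ℂ)) with hη
  -- unfold the line: framed log-chart minus frame-free log-chart plus `t·(∂∘Dh∘leftVel)(Y)(c)`
  have hfun : (fun t : ℂ => NegSup.equiv _ _ (CprOfRecord F N K k Ω U₀ 𝔥 levB (t • A) - COfRecord F N K k Ω U₀ levB (t • A)) c)
      = fun t : ℂ =>
          logOver (coeField (Averaging.iter (fun j => blockAvg (P := F.P K) (j := j) expMeanLogSU) k U₀)) (avPrM 𝔥 (expOver U₀ (t • (η • Y)))) c
            - logOver (coeField (Averaging.iter (fun j => blockAvg (P := F.P K) (j := j) expMeanLogSU) k U₀))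
                (avPrM (FrameDatum.frameless k U₀) (expOver U₀ (t • (η • Y)))) c
            + t • frameCorr k U₀ (𝔥.deriv (leftVelC U₀ Y)) c := by
    funext t
    show NegSup.equiv _ _ (CprOfRecord F N K k Ω U₀ 𝔥 levB (t • A)) c - NegSup.equiv _ _ (COfRecord F N K k Ω U₀ levB (t • A)) c = _
    rw [CprOfRecord_apply, COfRecord_apply, logOver_apply, logOver_apply, avPrM_frameless, coeField_apply, map_smul, smul_comm η t, qPrCplxOp_apply,
      Pi.sub_apply, map_smul, map_smul, map_smul, map_smul, Pi.smul_apply, Pi.smul_apply]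
    have e : ∀ a b q f : Matrix (Fin N) (Fin N) ℂ, a - (q - f) - (b - q) = a - b + f := fun a b q f => by abel
    exact e _ _ _ _
  rw [hfun]
  have h1 := hasDerivAt_logChart_avPrM_line U₀ 𝔥 hU₀ (η • Y) c
  have h2 := hasDerivAt_logChart_avPrM_line U₀ (FrameDatum.frameless k U₀) hU₀ (η • Y) c
  have h3 : HasDerivAt (fun t : ℂ => t • frameCorr k U₀ (𝔥.deriv (leftVelC U₀ Y)) c) (frameCorr k U₀ (𝔥.deriv (leftVelC U₀ Y)) c) 0 := by
    have h := (hasDerivAt_id (0 : ℂ)).smul_const (frameCorr k U₀ (𝔥.deriv (leftVelC U₀ Y)) c)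
    rwa [one_smul] at h
  refine ((h1.sub h2).add h3).congr_deriv ?_
  rw [FrameDatum.frameless_deriv, _root_.zero_apply, Pi.zero_apply, Pi.zero_apply, mul_zero, zero_mul, sub_zero, smul_zero, add_zero,
    add_sub_cancel_left]
  -- `Dh[iηY·U₀] = (iη)·Dh[Y·U₀]`
  have hV : (fun b : PBond (F.P K) 0 => (Complex.I • (η • Y) b) * (U₀ b : Matrix (Fin N) (Fin N) ℂ)) = (Complex.I * η) • leftVelC U₀ Y := by
    funext b
    rw [Pi.smul_apply, Pi.smul_apply, leftVelC_apply, smul_smul, smul_mul_assoc]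
  rw [hV, map_smul, Pi.smul_apply, Pi.smul_apply, frameCorr_apply, ← coeField_iter_eq_iterM k hU₀, coeField_apply, mul_smul_comm, smul_mul_assoc, ← smul_sub,
    smul_smul, ← mul_assoc, inv_mul_cancel₀ Complex.I_ne_zero, one_mul, hη, eta_cast_eq_inv_L_pow, ← smul_add, sub_add_sub_cancel, sub_self, smul_zero]

/-- ★★★ **KERNEL GUARD `D(C^{pr} − C)(0) = 0`** — under the small-field guard of `U₀` below `k` the framed remainder `C^{pr}` over ANY frame datum and the
frame-free remainder `C` of file 3e′ have the same derivative at `A′ = 0` (namely the derivative of the un-framed log-chart minus `q^{ff}`, on both sides):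
the frame's first-order contribution `∂∘Dh` is exactly what `Q^{pr} = q^{ff} − ∂∘Dh∘leftVel` removes.  Mechanical certificate of the sign∕placement
conventions of §1 (second reader RR-2 READ 13 (α), hand-KLC, 2026-08-31): with the opposite sign the left side would be `2·frameCorr ∘ Dh ∘ leftVel ∘ ev ≠ 0`.
[cite: Balaban1985Variational, (44) p.285, (55) p.286; Balaban1985BackgroundPropagators, (3.113)–(3.115) p.418; Balaban1985Averaging, (92) p.31] -/
theorem hasFDerivAt_CprOfRecord_sub_COfRecord_zero [Fact (0 < (F.L : ℝ))] [Fact (0 < (F.P K).eta k)] (𝔥 : FrameDatum (F.P K) N k U₀)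
    (levB : PBond (F.P K) k → ℕ) (hU₀ : SmallBelow (avOfRecord F N K) k U₀) :
    HasFDerivAt (fun A => CprOfRecord F N K k Ω U₀ 𝔥 levB A - COfRecord F N K k Ω U₀ levB A)
      (0 : Space115Lit F N K k Ω U₀ →L[ℂ] NegSize (F.L : ℝ) ((F.P K).eta k) levB 0 (Matrix (Fin N) (Fin N) ℂ)) 0 := by
  have hd : DifferentiableAt ℂ (fun A => CprOfRecord F N K k Ω U₀ 𝔥 levB A - COfRecord F N K k Ω U₀ levB A) 0 :=
    ((analyticAt_CprOfRecord_zero F N K k Ω U₀ 𝔥 levB hU₀).sub (analyticAt_COfRecord_zero F N k Ω U₀ levB hU₀)).differentiableAt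
  have hF := hd.hasFDerivAt
  suffices h0 : fderiv ℂ (fun A => CprOfRecord F N K k Ω U₀ 𝔥 levB A - COfRecord F N K k Ω U₀ levB A) 0 = 0 by rwa [h0] at hF
  ext A
  change fderiv ℂ (fun A => CprOfRecord F N K k Ω U₀ 𝔥 levB A - COfRecord F N K k Ω U₀ levB A) 0 A = 0
  set E := NegSup.continuousLinearEquiv ℂ (V := Matrix (Fin N) (Fin N) ℂ) (levWeight (F.L : ℝ) ((F.P K).eta k) levB 0) with hE
  have hline : HasDerivAt (fun t : ℂ => t • A) A 0 := by
    have h := (hasDerivAt_id (0 : ℂ)).smul_const A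
    rwa [one_smul] at h
  have hEF : HasFDerivAt (fun A' => E (CprOfRecord F N K k Ω U₀ 𝔥 levB A' - COfRecord F N K k Ω U₀ levB A'))
      ((E : NegSize (F.L : ℝ) ((F.P K).eta k) levB 0 (Matrix (Fin N) (Fin N) ℂ) →L[ℂ] (PBond (F.P K) k → Matrix (Fin N) (Fin N) ℂ)).comp
        (fderiv ℂ (fun A => CprOfRecord F N K k Ω U₀ 𝔥 levB A - COfRecord F N K k Ω U₀ levB A) 0)) 0 :=
    E.hasFDerivAt.comp 0 hF
  have hcurve := hEF.comp_hasDerivAt_of_eq (0 : ℂ) hline (zero_smul ℂ A).symm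
  have hzero : HasDerivAt ((fun A' => E (CprOfRecord F N K k Ω U₀ 𝔥 levB A' - COfRecord F N K k Ω U₀ levB A')) ∘ fun t : ℂ => t • A) 0 0 := by
    refine hasDerivAt_pi.2 fun c => ?_
    exact (hasDerivAt_CprOfRecord_sub_COfRecord_line_zero F N K k Ω U₀ 𝔥 levB hU₀ A c).congr_of_eventuallyEq (Filter.Eventually.of_forall fun t => rfl)
  have huniq : ((E : NegSize (F.L : ℝ) ((F.P K).eta k) levB 0 (Matrix (Fin N) (Fin N) ℂ) →L[ℂ] (PBond (F.P K) k → Matrix (Fin N) (Fin N) ℂ)).comp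
      (fderiv ℂ (fun A => CprOfRecord F N K k Ω U₀ 𝔥 levB A - COfRecord F N K k Ω U₀ levB A) 0)) A = 0 := hcurve.unique hzero
  rw [ContinuousLinearMap.comp_apply] at huniq
  exact E.injective (by rw [map_zero]; exact huniq)

/-- ★★ **THE SAME ON THE SLICE: `D(C^{sl,pr} − C^{sl})(0) = 0`** (composition with the projection `P = slProjLit`, linear, `P 0 = 0`).
[cite: Balaban1985Variational, (44) p.285, (51) p.286, (55) p.286] -/
theorem hasFDerivAt_CslprOfRecord_sub_CslOfRecord_zero [Fact (0 < (F.L : ℝ))] [Fact (0 < (F.P K).eta k)] (𝔥 : FrameDatum (F.P K) N k U₀)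
    (levB : PBond (F.P K) k → ℕ) (hU₀ : SmallBelow (avOfRecord F N K) k U₀) :
    HasFDerivAt (fun A => CslprOfRecord F N K k Ω U₀ 𝔥 levB A - CslOfRecord F N K k Ω U₀ levB A)
      (0 : Space115Lit F N K k Ω U₀ →L[ℂ] NegSize (F.L : ℝ) ((F.P K).eta k) levB 0 (Matrix (Fin N) (Fin N) ℂ)) 0 := by
  have hP : HasFDerivAt (slProjLit F N K k Ω U₀ : Space115Lit F N K k Ω U₀ → Space115Lit F N K k Ω U₀) (slProjLit F N K k Ω U₀) 0 :=
    (slProjLit F N K k Ω U₀).hasFDerivAt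
  have hf : HasFDerivAt (fun A => CprOfRecord F N K k Ω U₀ 𝔥 levB A - COfRecord F N K k Ω U₀ levB A)
      (0 : Space115Lit F N K k Ω U₀ →L[ℂ] NegSize (F.L : ℝ) ((F.P K).eta k) levB 0 (Matrix (Fin N) (Fin N) ℂ)) (slProjLit F N K k Ω U₀ 0) := by
    rw [map_zero]
    exact hasFDerivAt_CprOfRecord_sub_COfRecord_zero F N K k Ω U₀ 𝔥 levB hU₀
  have h := hf.comp 0 hP
  rw [ContinuousLinearMap.zero_comp] at h
  exact h

/-- ★★★ **HENCE THE FRAMED (44)-AT-FIRST-ORDER TOKEN IS THE FRAME-FREE ONE**: under the guard, `DC^{sl,pr}(0) = 0 ⟺ DC^{sl}(0) = 0` (= file 3f′'s displayed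
`C1Tok`); so a row keyed on the framed `C` displays at first order exactly what the frame-free row displayed, for EVERY datum — content enters only at
second order and through the inhabitant. [cite: Balaban1985Variational, (44) p.285, (55)–(56) p.286, (51) p.286] -/
theorem hasFDerivAt_CslprOfRecord_zero_iff [Fact (0 < (F.L : ℝ))] [Fact (0 < (F.P K).eta k)] (𝔥 : FrameDatum (F.P K) N k U₀)
    (levB : PBond (F.P K) k → ℕ) (hU₀ : SmallBelow (avOfRecord F N K) k U₀) :
    HasFDerivAt (CslprOfRecord F N K k Ω U₀ 𝔥 levB)
        (0 : Space115Lit F N K k Ω U₀ →L[ℂ] NegSize (F.L : ℝ) ((F.P K).eta k) levB 0 (Matrix (Fin N) (Fin N) ℂ)) 0 ↔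
      C1Tok F N K k Ω U₀ levB := by
  have hd := hasFDerivAt_CslprOfRecord_sub_CslOfRecord_zero F N K k Ω U₀ 𝔥 levB hU₀
  constructor
  · intro h
    have h' := h.sub hd
    rw [sub_zero] at h'
    exact h'.congr_of_eventuallyEq (Filter.Eventually.of_forall fun A => (sub_sub_cancel _ _).symm)
  · intro h
    have h1 : HasFDerivAt (CslOfRecord F N K k Ω U₀ levB)
        (0 : Space115Lit F N K k Ω U₀ →L[ℂ] NegSize (F.L : ℝ) ((F.P K).eta k) levB 0 (Matrix (Fin N) (Fin N) ℂ)) 0 := h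
    have h' := hd.add h1
    rw [add_zero] at h'
    exact h'.congr_of_eventuallyEq (Filter.Eventually.of_forall fun A => (sub_add_cancel _ _).symm)

end Record

end Literature.MathematicalPhysics.QuantumFieldTheory.Balaban1983to89.Node00

end
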